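import Summits.BirchSwinnertonDyer.BirchSwinnertonDyer.Theorems.GoldfeldAllTwistsTwoConverseTwinAdditiveTamagawaTwoSeven
import Summits.BirchSwinnertonDyer.BirchSwinnertonDyer.Theorems.GoldfeldAllTwistsTwoConverseTwinAdditiveTamagawaOdd
import HarnessLib

set_option linter.dupNamespace false -- `…BirchSwinnertonDyer.BirchSwinnertonDyer…` is the cell's namespace (D-0017)
set_option autoImplicit false

/-!
# Twin″ (item 19140), the WHOLE additive cell — uniform local arithmetic, V: the TAMAGAWA PRODUCT LAW
# **`∏_p c_p(W) = 8 · ∏_{ℓ ∣ d, ℓ odd} c_ℓ = 2^(3 + ι(d) + 2σ(d))`** for every model `W` of `49a1^{(d)}`, `d` squarefree,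
# `d ≢ 1 (mod 4)`, `7 ∤ d`

Cell `bsd-goldfeld`, seat `bsd-goldfeld-s1p-c301` (prover, gen 11). Support for item `stmt-BirchSwinnertonDyer-19140`
(crux twin″ `BSDTwoCMSevenAdditiveRankOne`: Miller's `BSD(W,2)` on the additive CM-by-`ℚ(√−7)` cell; in the cell's
coordinates — seat c301 gen 3 `bsdTwoCMSevenAdditiveRankOne_iff_negTwists` — the curves are the models of `49a1^{(d)}`,
`d < 0` squarefree, `d ≢ 1 (mod 4)`, `7 ∤ d`). Theses-free; theorems only; no `sorry`. HONEST FRAMING: local arithmetic;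
nothing about `L`-values; BSD is not proved by any of this and no case of twin″ is claimed.

ASSEMBLY of files I–IV (`…TwinAdditiveCellModel`, `…TamagawaOdd`, `…TamagawaClassNegSix`, `…TamagawaTwoSeven`):
the bad places of the global minimal model `M_d` are among `2`, `7` and the primes of `d` (file I); `c₂ = 4` (file IV),
`c₇ = 2` (file IV), `c_ℓ = 2` / `4` at an odd `ℓ ∣ d` according as `(ℓ/7) = −1` / `+1` (file II, with `(−7/ℓ) = (ℓ/7)`);
the product formula `tamagawaProduct_eq_prod` over the places of `14·|d|` gives
* **`tamagawaProduct_cellTwist`**: `Tam(X₀(49)^{(4d)}) = 8 · ∏_{ℓ ∈ primeFactors |d|, ℓ ≠ 2} (2 if (ℓ/7) = −1, else 4)`;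
* **`tamagawaProduct_eq_of_smul_eq_cm7_quadraticTwist`**: the same for EVERY model `W` (`C • W = X₀(49)^{(d)}`; `Tam` is a
  `ℚ`-isomorphism invariant, `tamagawaProduct_variableChange_eq`).
So `ord₂ ∏_p c_p(W) = 3 + ι(d) + 2σ(d)` with `ι(d)` / `σ(d)` the number of odd prime factors of `d` inert / split in
`ℚ(√−7)`: the exponent `v` observed on all 7975 rank-one rows `|d| ≤ 20000` of the cell's BSD(E,2) census (memos
INERT7-FORMULA-CENSUS §0.2, B49K-SCOPING §2: «v ODD on the 7-inert half, EVEN on the 7-split half» is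
`(d/7) = (−1)^{1+ι(d)}`), now a theorem for every `d`. It is the local factor of the BSD₂ quotient
`#Ш_an(W) = L′(W,1)·#W(ℚ)_tors² / (Ω_W · ∏c_p · Reg_W)` of EVERY curve of twin″ (the prime families F1/F2 of THEOREM B/B′
are `ι + 2σ = 1 + 0`: `Tam = 16`, seat c301 gen 8/9 `tamagawaProduct_twist` / `…_twistEight`).
Numerics: kit j277601 (PARI, all 485 squarefree `|d| ≤ 400`): `∏ c_p = 2^(3+ι+2σ)` on every additive `d` with `7 ∤ d`.
References: [Silverman1994] IV.9.4, Table 4.1; [SilvermanAEC2009] VII.6; [Tate1975] §7.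
-/

noncomputable section

open scoped Classical NumberField

open WeierstrassCurve IsDedekindDomain IsLocalRing Rat.HeightOneSpectrum
  Literature.NumberTheory.EllipticCurves Literature.NumberTheory.EllipticCurves.ModularForms
  Literature.NumberTheory.QuadraticForms
  Summit.BirchSwinnertonDyer.BirchSwinnertonDyer.Rank2Observatory.Tate
  Summit.BirchSwinnertonDyer.BirchSwinnertonDyer.Rank2Observatory.RootNumber

namespace Summit.BirchSwinnertonDyer.BirchSwinnertonDyer.Theorems.GoldfeldGoodTwists

section Product

variable {d : ℤ}

/-- The local Tamagawa number of `X₀(49)^{(4d)}` at a prime `p` of `14·|d|`, as a function of `p` alone: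
`4` at `2`, `2` at `7`, and `2` / `4` at an odd `ℓ ∣ d` according as `(ℓ/7) = −1` / `+1` (files II, IV).
[cite: Silverman1994, IV.9.4 and Table 4.1] -/
theorem localTamagawaNumber_padic_cellTwist_of_mem_primeFactors (hsq : Squarefree d) (hd4 : d % 4 ≠ 1)
    (h7 : ¬ (7 : ℤ) ∣ d) {p : ℕ} [hp : Fact p.Prime] (hpmem : p ∈ (14 * d.natAbs).primeFactors) :
    (haveI := cm7.isElliptic_quadraticTwist (show (((4 * d : ℤ)) : ℚ) ≠ 0 by
       have := hsq.ne_zero; exact_mod_cast (show (4 * d : ℤ) ≠ 0 by omega))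
     ((cm7.quadraticTwist (((4 * d : ℤ)) : ℚ)).baseChange ℚ_[p]).localTamagawaNumber ℤ_[p]) =
      if p = 2 then 4 else if p = 7 then 2 else if jacobiSym p 7 = -1 then 2 else 4 := by
  have hpP : p.Prime := hp.out
  have hd0 : d ≠ 0 := hsq.ne_zero
  by_cases hp2 : p = 2
  · subst hp2
    rw [if_pos rfl]
    have e : hp = ⟨Nat.prime_two⟩ := Subsingleton.elim _ _
    subst e
    exact localTamagawaNumber_padic_cellTwist_two hsq hd4
  rw [if_neg hp2]
  by_cases hp7 : p = 7
  · subst hp7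
    rw [if_pos rfl]
    exact localTamagawaNumber_padic_cellTwist_seven h7
  rw [if_neg hp7]
  -- `p` is an odd prime `≠ 7` dividing `14·|d|`, hence dividing `d`
  have hpd : (p : ℤ) ∣ d := by
    have h1 : p ∣ 14 * d.natAbs := Nat.dvd_of_mem_primeFactors hpmem
    rcases (Nat.Prime.dvd_mul hpP).mp h1 with h14 | hdd
    · exfalso
      have : p ∣ 2 * 7 := by norm_num; exact h14
      rcases (Nat.Prime.dvd_mul hpP).mp this with h | h
      · exact hp2 ((Nat.prime_dvd_prime_iff_eq hpP Nat.prime_two).mp h)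
      · exact hp7 ((Nat.prime_dvd_prime_iff_eq hpP (by norm_num)).mp h)
    · exact Int.natCast_dvd.mpr hdd
  have hleg : legendreSym p (-7) = jacobiSym p 7 := legendreSym_neg_seven_eq_jacobiSym hp2
  by_cases hj : jacobiSym p 7 = -1
  · rw [if_pos hj]
    exact localTamagawaNumber_padic_cellModel_eq_two hsq hd4 hp2 hp7 hpd (by rw [hleg, hj])
  · rw [if_neg hj]
    -- `(p/7) ∈ {±1}` since `p ≠ 7` is prime; so `(p/7) = 1`
    have hj1 : jacobiSym p 7 = 1 := by
      rcases jacobiSym.eq_one_or_neg_one (a := (p : ℤ)) (b := 7) (by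
        rw [Int.gcd_natCast_natCast]
        exact (Nat.coprime_primes hpP (by norm_num)).mpr hp7) with h | h
      · exact h
      · exact (hj h).elim
    exact localTamagawaNumber_padic_cellModel_eq_four hsq hd4 hp2 hp7 hpd (by rw [hleg, hj1])

/-- **TAMAGAWA PRODUCT LAW of the additive cell.** For squarefree `d ≢ 1 (mod 4)` with `7 ∤ d`:
`Tam(X₀(49)^{(4d)}) = 8 · ∏_{ℓ ∈ primeFactors |d|, ℓ ≠ 2} (2 if (ℓ/7) = −1 else 4)` — `c₂·c₇ = 4·2` times `2` per inert and
`4` per split odd prime factor of `d`. [cite: Silverman1994, IV.9.4 and Table 4.1] [cite: SilvermanAEC2009, VII.6] -/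
theorem tamagawaProduct_cellTwist (hsq : Squarefree d) (hd4 : d % 4 ≠ 1) (h7 : ¬ (7 : ℤ) ∣ d) :
    (haveI := cm7.isElliptic_quadraticTwist (show (((4 * d : ℤ)) : ℚ) ≠ 0 by
       have := hsq.ne_zero; exact_mod_cast (show (4 * d : ℤ) ≠ 0 by omega))
     (cm7.quadraticTwist (((4 * d : ℤ)) : ℚ)).tamagawaProduct) =
      8 * ∏ l ∈ (d.natAbs.primeFactors.erase 2), (if jacobiSym l 7 = -1 then 2 else 4) := by
  have hd0 : d ≠ 0 := hsq.ne_zero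
  have hd : (((4 * d : ℤ)) : ℚ) ≠ 0 := by exact_mod_cast (show (4 * d : ℤ) ≠ 0 by omega)
  haveI := cm7.isElliptic_quadraticTwist hd
  -- the finite set of places of `14·|d|`
  set P : Finset ℕ := (14 * d.natAbs).primeFactors with hP
  have hPprime : ∀ p ∈ P, p.Prime := fun p hp => Nat.prime_of_mem_primeFactors hp
  set e : P → HeightOneSpectrum ℤ := fun p => (primesEquiv (R := ℤ)).symm ⟨p.1, hPprime p.1 p.2⟩ with he
  have he_inj : Function.Injective e := by
    intro p q hpq
    have := congrArg (fun v => ((primesEquiv (R := ℤ)) v : ℕ)) hpq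
    simp only [he, Equiv.apply_symm_apply] at this
    exact Subtype.ext this
  have he_val : ∀ p : P, (primesEquiv (e p) : ℕ) = p.1 := fun p => by simp only [he, Equiv.apply_symm_apply]
  set s : Finset (HeightOneSpectrum ℤ) := Finset.univ.image e with hs
  -- every bad place is in `s`
  have hprod := tamagawaProduct_eq_prod (cm7.quadraticTwist (((4 * d : ℤ)) : ℚ)) s (by
    intro v hv
    by_contra hmem
    apply hv
    rw [← cellModel_baseChange]
    refine hasGoodReductionAt_of_not_dvd fun hdvd => hmem ?_
    have hmemP : natGenerator v ∈ P := by
      rw [hP, Nat.mem_primeFactors]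
      refine ⟨prime_natGenerator v, ?_, by positivity⟩
      rcases dvd_of_prime_dvd_cellModel_Δ (prime_natGenerator v) hdvd with h | h | h
      · rw [h]; exact dvd_mul_of_dvd_left (by norm_num) _
      · rw [h]; exact dvd_mul_of_dvd_left (by norm_num) _
      · exact dvd_mul_of_dvd_right (Int.natCast_dvd.mp h) _
    rw [hs, Finset.mem_image]
    refine ⟨⟨natGenerator v, hmemP⟩, Finset.mem_univ _, ?_⟩
    apply (primesEquiv (R := ℤ)).injective
    rw [he]; simp only [Equiv.apply_symm_apply]
    exact Subtype.ext rfl)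
  rw [hprod, hs, Finset.prod_image (fun p _ q _ h => he_inj h)]
  -- evaluate each local factor
  have hfac : ∀ p : P, (haveI := Fact.mk (primesEquiv (e p)).2
      ((cm7.quadraticTwist (((4 * d : ℤ)) : ℚ)).baseChange ℚ_[primesEquiv (e p)]).localTamagawaNumber
        ℤ_[primesEquiv (e p)]) = (if p.1 = 2 then 4 else if p.1 = 7 then 2 else if jacobiSym p.1 7 = -1 then 2 else 4) := by
    intro p
    haveI : Fact p.1.Prime := ⟨hPprime p.1 p.2⟩
    refine localTamagawaNumber_padic_eq_of_forall_place _ (e p) p.1 (he_val p) _ (fun w hw => ?_)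
    rw [← localTamagawaNumber_padic_eq_holds _ w p.1 hw]
    exact localTamagawaNumber_padic_cellTwist_of_mem_primeFactors hsq hd4 h7 p.2
  rw [Finset.prod_congr rfl (fun p _ => hfac p)]
  -- back to a product over `P = {2, 7} ∪ (primeFactors |d| \ {2})`
  rw [Finset.prod_coe_sort P
    (fun p : ℕ => (if p = 2 then 4 else if p = 7 then 2 else if jacobiSym p 7 = -1 then 2 else 4 : ℕ))]
  have h2P : (2 : ℕ) ∉ insert 7 (d.natAbs.primeFactors.erase 2) := by
    simp [Finset.mem_insert, Finset.mem_erase]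
  have h7Q : (7 : ℕ) ∉ d.natAbs.primeFactors.erase 2 := by
    rw [Finset.mem_erase, Nat.mem_primeFactors]
    rintro ⟨-, -, h, -⟩
    exact h7 (by exact_mod_cast (Int.ofNat_dvd_left.mpr h : ((7 : ℕ) : ℤ) ∣ d))
  have hPeq : P = insert 2 (insert 7 (d.natAbs.primeFactors.erase 2)) := by
    ext p
    rw [hP, Finset.mem_insert, Finset.mem_insert, Finset.mem_erase, Nat.mem_primeFactors, Nat.mem_primeFactors]
    constructor
    · rintro ⟨hp, hdvd, -⟩
      by_cases hp2 : p = 2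
      · exact Or.inl hp2
      by_cases hp7 : p = 7
      · exact Or.inr (Or.inl hp7)
      refine Or.inr (Or.inr ⟨hp2, hp, ?_, Int.natAbs_ne_zero.mpr hd0⟩)
      rcases (Nat.Prime.dvd_mul hp).mp hdvd with h14 | hdd
      · exfalso
        have : p ∣ 2 * 7 := by norm_num; exact h14
        rcases (Nat.Prime.dvd_mul hp).mp this with h | h
        · exact hp2 ((Nat.prime_dvd_prime_iff_eq hp Nat.prime_two).mp h)
        · exact hp7 ((Nat.prime_dvd_prime_iff_eq hp (by norm_num)).mp h)
      · exact hdd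
    · rintro (rfl | rfl | ⟨-, hp, hdvd, -⟩)
      · exact ⟨Nat.prime_two, dvd_mul_of_dvd_left (by norm_num) _, by positivity⟩
      · exact ⟨by norm_num, dvd_mul_of_dvd_left (by norm_num) _, by positivity⟩
      · exact ⟨hp, dvd_mul_of_dvd_right hdvd _, by positivity⟩
  rw [hPeq, Finset.prod_insert h2P, Finset.prod_insert h7Q, if_pos rfl, if_neg (by norm_num), if_pos rfl]
  rw [show (4 : ℕ) * (2 * ∏ p ∈ d.natAbs.primeFactors.erase 2,
      (if p = 2 then 4 else if p = 7 then 2 else if jacobiSym p 7 = -1 then 2 else 4)) =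
      8 * ∏ p ∈ d.natAbs.primeFactors.erase 2,
      (if p = 2 then 4 else if p = 7 then 2 else if jacobiSym p 7 = -1 then 2 else 4) by ring]
  congr 1
  refine Finset.prod_congr rfl fun p hp => ?_
  have hp2 : p ≠ 2 := (Finset.mem_erase.mp hp).1
  have hp7 : p ≠ 7 := fun h => h7Q (h ▸ hp)
  rw [if_neg hp2, if_neg hp7]

/-- **`∏_p c_p(W) = 8 · ∏_{ℓ ∣ d odd} c_ℓ` FOR EVERY MODEL `W` of `49a1^{(d)}`** (`C • W = X₀(49)^{(d)}`, `d` squarefree,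
`d ≢ 1 (mod 4)`, `7 ∤ d`): `Tam` is a `ℚ`-isomorphism invariant (`tamagawaProduct_variableChange_eq`) and
`X₀(49)^{(d)} ≅ X₀(49)^{(4d)}`. The local factor of `#Ш_an(W)` for every curve of the additive cell.
[cite: Silverman1994, IV.9.4 and Table 4.1] [cite: SilvermanAEC2009, VII.6 and X.5 Cor. 5.4] -/
theorem tamagawaProduct_eq_of_smul_eq_cm7_quadraticTwist (hsq : Squarefree d) (hd4 : d % 4 ≠ 1)
    (h7 : ¬ (7 : ℤ) ∣ d) (W : WeierstrassCurve ℚ) [W.IsElliptic] (C : VariableChange ℚ)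
    (hC : C • W = cm7.quadraticTwist (d : ℚ)) :
    W.tamagawaProduct = 8 * ∏ l ∈ (d.natAbs.primeFactors.erase 2), (if jacobiSym l 7 = -1 then 2 else 4) := by
  have hd : (((4 * d : ℤ)) : ℚ) ≠ 0 := by
    have := hsq.ne_zero; exact_mod_cast (show (4 * d : ℤ) ≠ 0 by omega)
  haveI := cm7.isElliptic_quadraticTwist hd
  obtain ⟨C', hC'⟩ := exists_smul_eq_cellModel_baseChange W hC
  rw [cellModel_baseChange] at hC'
  have h := tamagawaProduct_variableChange_eq W C'
  rw [hC'] at h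
  rw [← h]
  exact tamagawaProduct_cellTwist hsq hd4 h7

/-- **`∏_p c_p = 2^(3 + ι(d) + 2σ(d))`** — the Tamagawa product law in exponent form: `ι(d)` / `σ(d)` = the number
of odd prime factors `ℓ` of `d` with `(ℓ/7) = −1` / `(ℓ/7) ≠ −1` (i.e. `= +1`: inert / split in `ℚ(√−7)`).
[cite: Silverman1994, IV.9.4 and Table 4.1] -/
theorem tamagawaProduct_cellTwist_eq_two_pow (hsq : Squarefree d) (hd4 : d % 4 ≠ 1) (h7 : ¬ (7 : ℤ) ∣ d) :
    (haveI := cm7.isElliptic_quadraticTwist (show (((4 * d : ℤ)) : ℚ) ≠ 0 by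
       have := hsq.ne_zero; exact_mod_cast (show (4 * d : ℤ) ≠ 0 by omega))
     (cm7.quadraticTwist (((4 * d : ℤ)) : ℚ)).tamagawaProduct) =
      2 ^ (3 + ((d.natAbs.primeFactors.erase 2).filter (fun l : ℕ => jacobiSym l 7 = -1)).card +
        2 * ((d.natAbs.primeFactors.erase 2).filter (fun l : ℕ => ¬ jacobiSym l 7 = -1)).card) := by
  rw [tamagawaProduct_cellTwist hsq hd4 h7, Finset.prod_ite, Finset.prod_const, Finset.prod_const, pow_add, pow_add,
    pow_mul]
  norm_num
  ring

end Product

end Summit.BirchSwinnertonDyer.BirchSwinnertonDyer.Theorems.GoldfeldGoodTwists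

end
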